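import Mathlib.Analysis.SpecialFunctions.Pow.Asymptotics
import Literature.Computability.Cryptography.IndistinguishabilityObfuscator
import HarnessLib

/-!
# `(t, δ)`-secure and sub-exponentially secure indistinguishability obfuscation

Topic `Literature/Computability/Cryptography` (definition item `defn-IsSubexpIO`; wanted by route
`QuantumAdvantage/WhiteBoxWalk`, crux `WbwObfuscatedGluedTrees`). Builds on
`IndistinguishabilityObfuscator.lean` (`CircuitObfuscator`, `SizedCircuit`, the classes
`sizeBoundedCircuits` / `ppolyCircuits`, the advised advantage `ioAdvantageAdv`, `IsIONonuniform`,
`IOExist`), adding the CONCRETE-SECURITY variants of the indistinguishability requirement.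

Bitansky–Paneth–Rosen (FOCS 2015), Def. 4.1: an iO `iO` for a class `𝒞` has
(1) functionality `Pr[∀ x : iO(C)(x) = C(x)] = 1` and (2) "for any polysize distinguisher `D` there
exists a negligible function `μ(·)`, such that for any two circuits `C₀, C₁ ∈ 𝒞` that compute the
same function and are of the same size `λ`: `|Pr[D(iO(C₀)) = 1] − Pr[D(iO(C₁)) = 1]| ≤ μ(λ)`";
"we further say that `iO` is **`(t, δ)`-secure**, for some function `t(·)` and concrete negligible
function `δ(·)`, if for all `t(λ)^{O(1)}` distinguishers the above indistinguishability gap `μ(λ)`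
is smaller than `δ(λ)^{Ω(1)}`", and §5.1 assumes "iO is a `(2^{λ^ε}, 2^{-λ^ε})`-secure
indistinguishability obfuscator for P/poly" (any fixed constant `ε < 1`). Jain–Lin–Sahai (STOC
2021), Def. 2.1–2.2: two ensembles are `(T, ε)`-indistinguishable if every adversary running in
time `T · poly(λ)` has gap `≤ ε(λ)` "for every sufficiently large `λ`"; "subexponentially
indistinguishable if `(T, 1/T)`-indistinguishable for `T(λ) = 2^{λ^c}` for some positive constant
`c`"; a `(T, γ)`-secure iO for polynomial-sized circuits has complete functionality and
`(T, γ)`-indistinguishable obfuscations of functionally equivalent same-size circuits; Thm. 1.1: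
sub-exponentially secure iO for `P/poly` exists under four sub-exponential well-founded assumptions.

## Contents

* `CircuitObfuscator.IsSecureIndistinguishable O t δ 𝒞` — `(t, δ)`-indistinguishability on the
  class `𝒞`: for every PPT distinguisher `D` and every advice sequence `a` with `|a κ| ≤ t κ` (for
  all large `κ`), for all sufficiently large `κ`, EVERY two same-size functionally equivalent
  circuits `C₀, C₁ ∈ 𝒞 κ` have `ioAdvantageAdv D a κ C₀ C₁ ≤ δ κ`;
* `IsSecureIO t δ 𝒞 O` — the bundle (efficiency, perfect functionality, polynomial slowdown,
  `(t, δ)`-indistinguishability), shaped exactly like `IsIONonuniform`;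
* `IsSubexpIO ε 𝒞 O := IsSecureIO (κ ↦ 2^{κ^ε}) (κ ↦ 2^{-κ^ε}) 𝒞 O` and the existence statement
  `SubexpIOExist ε` ("a `(2^{κ^ε}, 2^{-κ^ε})`-secure iO for `P/poly` exists"; an ASSUMPTION, used
  only as a hypothesis, like `IOExist`);
* API: `ioAdvantageAdv_le_one/_comm/_self`; antitonicity in the class and monotonicity in
  `(t, δ)` (`IsSecureIndistinguishable.anti/.mono`, `IsSecureIO.anti/.mono/.of_ppoly`);
  `IsSubexpIO.of_le` (antitone in `ε`), `SubexpIOExist.of_le`; and the COHERENCE THEOREMS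
  `IsSecureIndistinguishable.isIndistinguishableNonuniform` (if `t` eventually dominates every
  polynomial and `δ` is negligible then `(t, δ)`-security implies the asymptotic non-uniform
  security of `IndistinguishabilityObfuscator.lean`), `IsSecureIO.isIONonuniform`,
  `IsSubexpIO.isIONonuniform` (`0 < ε`), with the two growth facts they rest on
  (`eventually_natPoly_le_two_rpow`, `superpolynomialDecay_two_rpow_neg`).

## Design choices

* DISTINGUISHERS follow the tree's non-uniform convention (`IsIndistinguishableNonuniform`,
  `IsCompIndistinguishableNonuniform`, `IsOneWayNonuniform`): a PPT `RandAlg` with an advice string,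
  fed `⟨a κ, ⟨1^κ, code of iO(κ, C)⟩⟩` (`ioAdvantageAdv` = `acceptPMFAdv`). In
  `IsSecureIndistinguishable t δ` the advice may have length up to `t κ`, so the distinguisher runs
  in time `poly(t κ + κ + |iO(κ, C)|)` with `t κ` bits of non-uniformity — JLS's "time
  `T · poly(λ)`" adversaries made non-uniform, BPR's "`t(λ)^{O(1)}`(-size) distinguishers" up to the
  amount of advice (`t` versus `t^{O(1)}` bits). BPR's slack ("`t^{O(1)}` … `δ^{Ω(1)}`") is NOT
  built in; we follow JLS's exact `(T, ε)` form and the request (`t = 2^{λ^ε}`, `δ = 2^{-λ^ε}`).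
  For these parameters the exact and the slack versions sandwich each other under any decrease
  of the exponent (`c · κ^{ε'} ≤ κ^{ε}` for all large `κ` whenever `ε' < ε`, for every constant
  `c`), so hypotheses of the forms `∃ ε > 0, SubexpIOExist ε` and `∀ ε ∈ (0,1), SubexpIOExist ε`
  are robust; `IsSubexpIO.of_le` records antitonicity in `ε`.
* QUANTIFIER ORDER as printed in BPR Def. 4.1 and as in `IsIndistinguishableNonuniform`: the bound
  is UNIFORM over all admissible pairs of `𝒞 κ` (`∀ D a, ∀ᶠ κ, ∀ pairs`), which is what hybrid
  arguments over random keys consume, and it is required for all sufficiently large `κ` only (JLS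
  Def. 2.1 "for every sufficiently large `λ`"; a bound `≤ δ κ` at every `κ` against all PPT
  machines would force statistical closeness at small `κ`). The advice-length constraint is
  likewise eventual (advice at finitely many `κ` is immaterial), which makes monotonicity in `t`
  clean (`IsSecureIndistinguishable.mono`).
* SECURITY PARAMETER SYNTAX `iO(κ, C)` and the classes `𝒞 κ` are those of
  `IndistinguishabilityObfuscator.lean` (GGHRSW); BPR take `|C| = λ` — the same up to padding, cf.
  the footnote to Def. 2.2 of Bitansky–Degwekar–Vaikuntanathan 2021 ("the size of the obfuscated
  circuits equals the security parameter … without loss of generality"). `SubexpIOExist` is stated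
  for `ppolyCircuits` (all `B₂`-circuits with `n + #gates ≤ κ`), exactly as `IOExist`.
* Real-valued `t`, `δ` (`Real.rpow` for `2^{κ^ε}`); `IsSubexpIO ε` is intended for `0 < ε < 1`
  (for `ε ≤ 0` it is a polynomial-security notion of no interest; `IsSubexpIO.isIONonuniform` needs
  `0 < ε`).
* NOT here: uniform-distinguisher `(t, δ)` variants, quantum adversaries, `(t, δ)`-secure
  puncturable PRFs / injective OWFs (BPR Def. 4.2–4.3; separate definition items).

## References

* N. Bitansky, O. Paneth, A. Rosen, *On the cryptographic hardness of finding a Nash equilibrium*,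
  FOCS 2015 (read: 24-page full version): §4 preamble and Def. 4.1 (PDF p. 10), §5.1
  "Ingredients" (PDF pp. 11–12). [`BitanskyPanethRosen2015`]
* A. Jain, H. Lin, A. Sahai, *Indistinguishability obfuscation from well-founded assumptions*,
  STOC 2021 (read: arXiv:2008.09317): Def. 2.1, Def. 2.2, Thm. 1.1. [`JainLinSahai2021`]
* B. Barak et al., *On the (im)possibility of obfuscating programs*, J. ACM 59 (2012)
  [`BarakEtAl2012`]; S. Garg et al., FOCS 2013 [`GargEtAl2013`] — through
  `IndistinguishabilityObfuscator.lean`.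
* N. Bitansky, A. Degwekar, V. Vaikuntanathan, SIAM J. Comput. 50 (2021), Def. 2.2 and footnote
  (read). [`BitanskyDegwekarVaikuntanathan2021`]
-/

namespace Literature.Computability.Cryptography

open Filter Asymptotics _root_.Computability Complexity

namespace CircuitObfuscator

variable (O : CircuitObfuscator)

/-! ### The advised advantage: complements -/

/-- The advised iO advantage is at most `1` (both acceptance probabilities lie in `[0, 1]`).
[cite: GargEtAl2013, Def. 1] -/
theorem ioAdvantageAdv_le_one (D : RandAlg (List Bool) Bool) (a : ℕ → List Bool) (κ : ℕ) {n : ℕ}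
    (C₀ C₁ : Circuit (Fin n)) : O.ioAdvantageAdv D a κ C₀ C₁ ≤ 1 := by
  unfold ioAdvantageAdv
  have h1 : (acceptPMFAdv D a κ (O.obfCodePMF κ C₀) true).toReal ≤ 1 :=
    ENNReal.toReal_le_of_le_ofReal zero_le_one (by simpa using PMF.coe_le_one _ _)
  have h2 : (acceptPMFAdv D a κ (O.obfCodePMF κ C₁) true).toReal ≤ 1 :=
    ENNReal.toReal_le_of_le_ofReal zero_le_one (by simpa using PMF.coe_le_one _ _)
  have h1' : 0 ≤ (acceptPMFAdv D a κ (O.obfCodePMF κ C₀) true).toReal := ENNReal.toReal_nonneg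
  have h2' : 0 ≤ (acceptPMFAdv D a κ (O.obfCodePMF κ C₁) true).toReal := ENNReal.toReal_nonneg
  rw [abs_sub_le_iff]
  constructor <;> linarith

/-- The advised iO advantage is symmetric in the two circuits. [cite: GargEtAl2013, Def. 1] -/
theorem ioAdvantageAdv_comm (D : RandAlg (List Bool) Bool) (a : ℕ → List Bool) (κ : ℕ) {n : ℕ}
    (C₀ C₁ : Circuit (Fin n)) : O.ioAdvantageAdv D a κ C₀ C₁ = O.ioAdvantageAdv D a κ C₁ C₀ :=
  abs_sub_comm _ _

/-- The advised iO advantage between a circuit and itself vanishes. [cite: GargEtAl2013, Def. 1] -/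
@[simp] theorem ioAdvantageAdv_self (D : RandAlg (List Bool) Bool) (a : ℕ → List Bool) (κ : ℕ)
    {n : ℕ} (C : Circuit (Fin n)) : O.ioAdvantageAdv D a κ C C = 0 := by
  simp [ioAdvantageAdv]

/-! ### `(t, δ)`-indistinguishability -/

/-- `O.IsSecureIndistinguishable t δ 𝒞` (**`(t, δ)`-indistinguishability** on the class `𝒞`): for
every PPT distinguisher `D` and every advice sequence `a` of length `|a κ| ≤ t κ` for all large
`κ`, for all sufficiently large `κ`, every two circuits `C₀, C₁ ∈ 𝒞 κ` of the same size computing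
the same function satisfy
`|Pr[D(a κ, 1^κ, iO(κ, C₀)) = 1] − Pr[D(a κ, 1^κ, iO(κ, C₁)) = 1]| ≤ δ κ`.
BPR Def. 4.1: "`(t, δ)`-secure … if for all `t(λ)^{O(1)}` distinguishers the above
indistinguishability gap `μ(λ)` is smaller than `δ(λ)^{Ω(1)}`", rendered in the exact form of
JLS Def. 2.1 (time `T · poly(λ)`, gap `≤ ε(λ)` for every sufficiently large `λ`) with the tree's
advice convention for non-uniformity (module docstring). The asymptotic notion
`IsIndistinguishableNonuniform` is recovered when `t` dominates every polynomial and `δ` is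
negligible (`IsSecureIndistinguishable.isIndistinguishableNonuniform`).
[cite: BitanskyPanethRosen2015, Def. 4.1] -/
def IsSecureIndistinguishable (t δ : ℕ → ℝ) (𝒞 : ℕ → Set SizedCircuit) : Prop :=
  ∀ D : RandAlg (List Bool) Bool, IsPPT D encodeBool →
    ∀ a : ℕ → List Bool, (∀ᶠ κ in atTop, ((a κ).length : ℝ) ≤ t κ) →
      ∀ᶠ κ in atTop, ∀ (n : ℕ) (C₀ C₁ : Circuit (Fin n)), (⟨n, C₀⟩ : SizedCircuit) ∈ 𝒞 κ →
        (⟨n, C₁⟩ : SizedCircuit) ∈ 𝒞 κ → C₀.size = C₁.size → (∀ x, C₀.eval x = C₁.eval x) →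
          O.ioAdvantageAdv D a κ C₀ C₁ ≤ δ κ

variable {O}

/-- `(t, δ)`-indistinguishability on a class gives it on every subclass.
[cite: BitanskyPanethRosen2015, Def. 4.1] -/
theorem IsSecureIndistinguishable.anti {t δ : ℕ → ℝ} {𝒞 𝒞' : ℕ → Set SizedCircuit}
    (h : O.IsSecureIndistinguishable t δ 𝒞) (h' : ∀ κ, 𝒞' κ ⊆ 𝒞 κ) :
    O.IsSecureIndistinguishable t δ 𝒞' := fun D hD a ha =>
  (h D hD a ha).mono fun κ hκ n C₀ C₁ h₀ h₁ => hκ n C₀ C₁ (h' κ h₀) (h' κ h₁)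

/-- **Monotonicity in `(t, δ)`**: fewer or weaker distinguishers (`t' ≤ t` eventually) and a weaker
bound (`δ ≤ δ'` eventually) preserve `(t, δ)`-indistinguishability.
[cite: BitanskyPanethRosen2015, Def. 4.1] -/
theorem IsSecureIndistinguishable.mono {t δ t' δ' : ℕ → ℝ} {𝒞 : ℕ → Set SizedCircuit}
    (h : O.IsSecureIndistinguishable t δ 𝒞) (ht : ∀ᶠ κ in atTop, t' κ ≤ t κ)
    (hδ : ∀ᶠ κ in atTop, δ κ ≤ δ' κ) : O.IsSecureIndistinguishable t' δ' 𝒞 := by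
  intro D hD a ha
  have ha' : ∀ᶠ κ in atTop, ((a κ).length : ℝ) ≤ t κ := by
    filter_upwards [ha, ht] with κ hκ hκ' using hκ.trans hκ'
  filter_upwards [h D hD a ha', hδ] with κ hκ hκ' n C₀ C₁ h₀ h₁ hs he using
    (hκ n C₀ C₁ h₀ h₁ hs he).trans hκ'

/-- **Concrete security implies asymptotic security.** If `t` eventually dominates every
polynomial and `δ` is negligible, `(t, δ)`-indistinguishability on `𝒞` implies
`IsIndistinguishableNonuniform 𝒞`: a polynomial-length advice is admissible, and the negligible
bound is `κ ↦ δ κ` from the threshold on and `1` before it (`ioAdvantageAdv_le_one`).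
[cite: BitanskyPanethRosen2015, Def. 4.1] -/
theorem IsSecureIndistinguishable.isIndistinguishableNonuniform {t δ : ℕ → ℝ}
    {𝒞 : ℕ → Set SizedCircuit} (h : O.IsSecureIndistinguishable t δ 𝒞)
    (ht : ∀ p : Polynomial ℕ, ∀ᶠ κ : ℕ in atTop, ((p.eval κ : ℕ) : ℝ) ≤ t κ)
    (hδ : SuperpolynomialDecay atTop (fun κ : ℕ => (κ : ℝ)) δ) :
    O.IsIndistinguishableNonuniform 𝒞 := by
  classical
  intro D hD a ha
  obtain ⟨p, hp⟩ := ha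
  have ha' : ∀ᶠ κ in atTop, ((a κ).length : ℝ) ≤ t κ :=
    (ht p).mono fun κ hκ => le_trans (by exact_mod_cast hp κ) hκ
  obtain ⟨κ₀, hκ₀⟩ := eventually_atTop.1 (h D hD a ha')
  refine ⟨fun κ => if κ₀ ≤ κ then δ κ else 1, ?_, fun κ n C₀ C₁ h₀ h₁ hs he => ?_⟩
  · refine hδ.congr' ?_
    filter_upwards [eventually_ge_atTop κ₀] with κ hκ
    rw [if_pos hκ]
  · show O.ioAdvantageAdv D a κ C₀ C₁ ≤ if κ₀ ≤ κ then δ κ else 1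
    by_cases hκ : κ₀ ≤ κ
    · rw [if_pos hκ]
      exact hκ₀ κ hκ n C₀ C₁ h₀ h₁ hs he
    · rw [if_neg hκ]
      exact O.ioAdvantageAdv_le_one D a κ C₀ C₁

end CircuitObfuscator

/-! ### `(t, δ)`-secure iO, sub-exponentially secure iO -/

/-- `IsSecureIO t δ 𝒞 O`: `O` is a **`(t, δ)`-secure indistinguishability obfuscator** for the
circuit class `𝒞` — a uniform PPT algorithm with perfect functionality and polynomial slowdown on
`𝒞` (the syntactic requirements of `IsIO` / `IsIONonuniform`) whose obfuscations of same-size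
functionally equivalent circuits of `𝒞` are `(t, δ)`-indistinguishable
(`CircuitObfuscator.IsSecureIndistinguishable`). BPR Def. 4.1 ("A PPT algorithm `iO` … is
`(t, δ)`-secure …"); JLS Def. 2.2 ("`(T, γ)`-secure indistinguishability obfuscator for
polynomial-sized circuits"). [cite: BitanskyPanethRosen2015, Def. 4.1] -/
structure IsSecureIO (t δ : ℕ → ℝ) (𝒞 : ℕ → Set SizedCircuit) (O : CircuitObfuscator) : Prop where
  /-- The obfuscator is probabilistic polynomial-time. -/
  isEfficient : O.IsEfficient
  /-- Perfect functionality on the class. -/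
  preserves : O.PreservesFunctionality 𝒞
  /-- Polynomial slowdown on the class. -/
  slowdown : O.HasPolySlowdown 𝒞
  /-- `(t, δ)`-indistinguishability on the class. -/
  indist : O.IsSecureIndistinguishable t δ 𝒞

/-- `IsSubexpIO ε 𝒞 O`: `O` is a **`(2^{κ^ε}, 2^{-κ^ε})`-secure** ("sub-exponentially secure")
indistinguishability obfuscator for the class `𝒞` — BPR §5.1: "Fix any constant `ε < 1` … iO is
a `(2^{λ^ε}, 2^{-λ^ε})`-secure indistinguishability obfuscator for P/poly"; JLS Def. 2.1:
"subexponentially indistinguishable if `(T, 1/T)`-indistinguishable for `T(λ) = 2^{λ^c}` for some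
positive constant `c`". Real exponent (`Real.rpow`), intended for `0 < ε < 1`.
[cite: BitanskyPanethRosen2015, §5.1] -/
def IsSubexpIO (ε : ℝ) (𝒞 : ℕ → Set SizedCircuit) (O : CircuitObfuscator) : Prop :=
  IsSecureIO (fun κ => (2 : ℝ) ^ ((κ : ℝ) ^ ε)) (fun κ => (2 : ℝ) ^ (-((κ : ℝ) ^ ε))) 𝒞 O

/-- ASSUMPTION — `SubexpIOExist ε`: **a `(2^{κ^ε}, 2^{-κ^ε})`-secure indistinguishability
obfuscator for `P/poly` exists** (`IsSubexpIO ε` for the class `ppolyCircuits` of GGHRSW Def. 2,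
as in `IOExist`). The hypothesis of BPR 2015, §5.1 (any fixed `ε < 1`); by Jain–Lin–Sahai 2021,
Thm. 1.1 a consequence, for some `ε > 0`, of the sub-exponential hardness of SXDH, LWE, LPN over
large fields and of PRGs in `NC⁰` — a conditional theorem; unconditionally neither proved nor
refuted. Registered as an open statement, used only as a hypothesis `(h : SubexpIOExist ε)`;
`IsSubexpIO.isIONonuniform` relates it to `IsIONonuniform`.
[cite: BitanskyPanethRosen2015, §5.1] [status: open] -/
def SubexpIOExist (ε : ℝ) : Prop :=
  ∃ O : CircuitObfuscator, IsSubexpIO ε ppolyCircuits O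

/-! ### API -/

/-- Unfolding of `IsSubexpIO`. [cite: BitanskyPanethRosen2015, §5.1] -/
theorem isSubexpIO_iff (ε : ℝ) (𝒞 : ℕ → Set SizedCircuit) (O : CircuitObfuscator) :
    IsSubexpIO ε 𝒞 O ↔
      IsSecureIO (fun κ => (2 : ℝ) ^ ((κ : ℝ) ^ ε)) (fun κ => (2 : ℝ) ^ (-((κ : ℝ) ^ ε))) 𝒞 O :=
  Iff.rfl

/-- A `(t, δ)`-secure iO for a class is one for every subclass.
[cite: BitanskyPanethRosen2015, Def. 4.1] -/
theorem IsSecureIO.anti {t δ : ℕ → ℝ} {𝒞 𝒞' : ℕ → Set SizedCircuit} {O : CircuitObfuscator}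
    (h : IsSecureIO t δ 𝒞 O) (h' : ∀ κ, 𝒞' κ ⊆ 𝒞 κ) : IsSecureIO t δ 𝒞' O :=
  ⟨h.isEfficient, h.preserves.anti h', h.slowdown.anti h', h.indist.anti h'⟩

/-- Monotonicity of `(t, δ)`-security in `(t, δ)` (`t' ≤ t` and `δ ≤ δ'` eventually).
[cite: BitanskyPanethRosen2015, Def. 4.1] -/
theorem IsSecureIO.mono {t δ t' δ' : ℕ → ℝ} {𝒞 : ℕ → Set SizedCircuit} {O : CircuitObfuscator}
    (h : IsSecureIO t δ 𝒞 O) (ht : ∀ᶠ κ in atTop, t' κ ≤ t κ) (hδ : ∀ᶠ κ in atTop, δ κ ≤ δ' κ) :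
    IsSecureIO t' δ' 𝒞 O :=
  ⟨h.isEfficient, h.preserves, h.slowdown, h.indist.mono ht hδ⟩

/-- A `(t, δ)`-secure iO for `P/poly` is one for every class `sizeBoundedCircuits s` with `s ≤ id`.
[cite: BitanskyPanethRosen2015, Def. 4.1] -/
theorem IsSecureIO.of_ppoly {t δ : ℕ → ℝ} {O : CircuitObfuscator} (h : IsSecureIO t δ ppolyCircuits O)
    {s : ℕ → ℕ} (hs : ∀ κ, s κ ≤ κ) : IsSecureIO t δ (sizeBoundedCircuits s) O :=
  h.anti fun κ => sizeBoundedCircuits_mono hs κ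

/-- `(t, δ)`-security with `t` eventually above every polynomial and `δ` negligible implies the
asymptotic non-uniform notion `IsIONonuniform`. [cite: BitanskyPanethRosen2015, Def. 4.1] -/
theorem IsSecureIO.isIONonuniform {t δ : ℕ → ℝ} {𝒞 : ℕ → Set SizedCircuit} {O : CircuitObfuscator}
    (h : IsSecureIO t δ 𝒞 O) (ht : ∀ p : Polynomial ℕ, ∀ᶠ κ : ℕ in atTop, ((p.eval κ : ℕ) : ℝ) ≤ t κ)
    (hδ : SuperpolynomialDecay atTop (fun κ : ℕ => (κ : ℝ)) δ) : IsIONonuniform 𝒞 O :=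
  ⟨h.isEfficient, h.preserves, h.slowdown, h.indist.isIndistinguishableNonuniform ht hδ⟩

/-- A sub-exponentially secure iO for a class is one for every subclass.
[cite: BitanskyPanethRosen2015, §5.1] -/
theorem IsSubexpIO.anti {ε : ℝ} {𝒞 𝒞' : ℕ → Set SizedCircuit} {O : CircuitObfuscator}
    (h : IsSubexpIO ε 𝒞 O) (h' : ∀ κ, 𝒞' κ ⊆ 𝒞 κ) : IsSubexpIO ε 𝒞' O :=
  IsSecureIO.anti h h'

/-- **Antitonicity in the exponent**: a `(2^{κ^ε}, 2^{-κ^ε})`-secure iO is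
`(2^{κ^ε'}, 2^{-κ^ε'})`-secure for every `ε' ≤ ε` (`κ^{ε'} ≤ κ^{ε}` for `κ ≥ 1`).
[cite: BitanskyPanethRosen2015, §5.1] -/
theorem IsSubexpIO.of_le {ε ε' : ℝ} {𝒞 : ℕ → Set SizedCircuit} {O : CircuitObfuscator}
    (h : IsSubexpIO ε 𝒞 O) (hle : ε' ≤ ε) : IsSubexpIO ε' 𝒞 O := by
  have hpow : ∀ᶠ κ : ℕ in atTop, (κ : ℝ) ^ ε' ≤ (κ : ℝ) ^ ε := by
    filter_upwards [eventually_ge_atTop 1] with κ hκ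
    exact Real.rpow_le_rpow_of_exponent_le (by exact_mod_cast hκ) hle
  refine IsSecureIO.mono h ?_ ?_
  · filter_upwards [hpow] with κ hκ
    exact Real.rpow_le_rpow_of_exponent_le one_le_two hκ
  · filter_upwards [hpow] with κ hκ
    exact Real.rpow_le_rpow_of_exponent_le one_le_two (neg_le_neg hκ)

/-- If a `(2^{κ^ε}, 2^{-κ^ε})`-secure iO for `P/poly` exists then so does a
`(2^{κ^ε'}, 2^{-κ^ε'})`-secure one for every `ε' ≤ ε` (the same obfuscator).
[cite: BitanskyPanethRosen2015, §5.1] -/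
theorem SubexpIOExist.of_le {ε ε' : ℝ} (h : SubexpIOExist ε) (hle : ε' ≤ ε) : SubexpIOExist ε' := by
  obtain ⟨O, hO⟩ := h
  exact ⟨O, hO.of_le hle⟩

/-! ### Growth facts: `2^{κ^ε}` beats every polynomial, `2^{-κ^ε}` is negligible (`0 < ε`) -/

/-- `x^s · 2^{-x^ε} → 0` as `x → ∞` (`0 < ε`): substitute `y = x^ε → ∞` in
`y^{s/ε} · e^{-(log 2) y} → 0`. [folklore] -/
theorem tendsto_rpow_mul_two_rpow_neg_rpow (s : ℝ) {ε : ℝ} (hε : 0 < ε) :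
    Tendsto (fun x : ℝ => x ^ s * (2 : ℝ) ^ (-(x ^ ε))) atTop (nhds 0) := by
  have h1 : Tendsto (fun y : ℝ => y ^ (s / ε) * Real.exp (-Real.log 2 * y)) atTop (nhds 0) :=
    tendsto_rpow_mul_exp_neg_mul_atTop_nhds_zero (s / ε) (Real.log 2) (Real.log_pos one_lt_two)
  refine (h1.comp (tendsto_rpow_atTop hε)).congr' ?_
  filter_upwards [eventually_ge_atTop 0] with x hx
  simp only [Function.comp_apply]
  rw [← Real.rpow_mul hx, mul_div_cancel₀ _ hε.ne', Real.rpow_def_of_pos two_pos]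
  congr 1
  ring_nf

/-- `κ^k · 2^{-κ^ε} → 0` along the naturals (`0 < ε`). [folklore] -/
theorem tendsto_pow_mul_two_rpow_neg_rpow (k : ℕ) {ε : ℝ} (hε : 0 < ε) :
    Tendsto (fun κ : ℕ => (κ : ℝ) ^ k * (2 : ℝ) ^ (-((κ : ℝ) ^ ε))) atTop (nhds 0) := by
  have h := (tendsto_rpow_mul_two_rpow_neg_rpow (k : ℝ) hε).comp tendsto_natCast_atTop_atTop
  refine h.congr' (Eventually.of_forall fun κ => ?_)
  simp only [Function.comp_apply, Real.rpow_natCast]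

/-- **`2^{-κ^ε}` is negligible** (superpolynomial decay) for `0 < ε`. [folklore] -/
theorem superpolynomialDecay_two_rpow_neg {ε : ℝ} (hε : 0 < ε) :
    SuperpolynomialDecay atTop (fun κ : ℕ => (κ : ℝ)) fun κ => (2 : ℝ) ^ (-((κ : ℝ) ^ ε)) :=
  fun k => tendsto_pow_mul_two_rpow_neg_rpow k hε

/-- An `ℕ`-polynomial is bounded by its value at `1` times `n^{deg}` for `n ≥ 1` (twin of
`Complexity.natPoly_eval_le_eval_one_mul_pow`, outside this file's import cone). [folklore] -/
private theorem eval_le_eval_one_mul_pow (p : Polynomial ℕ) {n : ℕ} (hn : 1 ≤ n) :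
    p.eval n ≤ p.eval 1 * n ^ p.natDegree := by
  rw [Polynomial.eval_eq_sum_range, Polynomial.eval_eq_sum_range, Finset.sum_mul]
  refine Finset.sum_le_sum fun i hi => ?_
  rw [Finset.mem_range] at hi
  rw [one_pow, mul_one]
  exact Nat.mul_le_mul_left _ (Nat.pow_le_pow_right hn (by omega))

/-- **Every polynomial is eventually below `2^{κ^ε}`** (`0 < ε`): `p(κ) ≤ p(1) κ^d ≤ κ^{d+1}` for
`κ ≥ p(1)`, and `κ^{d+1} · 2^{-κ^ε} ≤ 1` eventually. [folklore] -/
theorem eventually_natPoly_le_two_rpow (p : Polynomial ℕ) {ε : ℝ} (hε : 0 < ε) :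
    ∀ᶠ κ : ℕ in atTop, ((p.eval κ : ℕ) : ℝ) ≤ (2 : ℝ) ^ ((κ : ℝ) ^ ε) := by
  have h1 : ∀ᶠ κ : ℕ in atTop, (κ : ℝ) ^ (p.natDegree + 1) * (2 : ℝ) ^ (-((κ : ℝ) ^ ε)) ≤ 1 :=
    (tendsto_pow_mul_two_rpow_neg_rpow (p.natDegree + 1) hε).eventually
      (eventually_le_nhds zero_lt_one)
  filter_upwards [h1, eventually_ge_atTop (max 1 (p.eval 1))] with κ hκ hκ'
  have hκ1 : 1 ≤ κ := le_of_max_le_left hκ'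
  have hκp : p.eval 1 ≤ κ := le_of_max_le_right hκ'
  have hpos : 0 < (2 : ℝ) ^ ((κ : ℝ) ^ ε) := Real.rpow_pos_of_pos two_pos _
  have h2 : ((p.eval κ : ℕ) : ℝ) ≤ (κ : ℝ) ^ (p.natDegree + 1) := by
    have h3 : p.eval κ ≤ κ ^ (p.natDegree + 1) :=
      (eval_le_eval_one_mul_pow p hκ1).trans (by rw [pow_succ']; exact Nat.mul_le_mul_right _ hκp)
    exact_mod_cast h3
  rw [Real.rpow_neg zero_le_two, ← div_eq_mul_inv, div_le_one hpos] at hκ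
  exact h2.trans hκ

/-- **Sub-exponential security implies asymptotic security**: a `(2^{κ^ε}, 2^{-κ^ε})`-secure iO
(`0 < ε`) is an iO against non-uniform PPT distinguishers in the sense of `IsIONonuniform`.
[cite: BitanskyPanethRosen2015, Def. 4.1 and §5.1] -/
theorem IsSubexpIO.isIONonuniform {ε : ℝ} {𝒞 : ℕ → Set SizedCircuit} {O : CircuitObfuscator}
    (h : IsSubexpIO ε 𝒞 O) (hε : 0 < ε) : IsIONonuniform 𝒞 O :=
  IsSecureIO.isIONonuniform h (fun p => eventually_natPoly_le_two_rpow p hε)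
    (superpolynomialDecay_two_rpow_neg hε)

/-- If a sub-exponentially secure iO for `P/poly` exists (`0 < ε`) then an iO for `P/poly` secure
against non-uniform PPT distinguishers exists. [cite: BitanskyPanethRosen2015, §5.1] -/
theorem SubexpIOExist.exists_isIONonuniform {ε : ℝ} (h : SubexpIOExist ε) (hε : 0 < ε) :
    ∃ O : CircuitObfuscator, IsIONonuniform ppolyCircuits O := by
  obtain ⟨O, hO⟩ := h
  exact ⟨O, hO.isIONonuniform hε⟩

end Literature.Computability.Cryptography
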